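import Summits.BirchSwinnertonDyer.BirchSwinnertonDyer.Theorems.PrintCf2RubinValueTwoRowTwoSUnitRadical
import Summits.BirchSwinnertonDyer.BirchSwinnertonDyer.Theorems.PrintCf2RubinValueTwoRowTwoTwistedKummerConjTwist
import Summits.BirchSwinnertonDyer.BirchSwinnertonDyer.Theorems.PrintCf2RubinValueTwoRowTwoTwistedKummerInjective
import Literature.NumberTheory.GaloisRepresentations.GaloisSubgroups
import Literature.NumberTheory.Automorphic.GaloisActionPlaces
import HarnessLib

/-!
# M-LINE-PIN / (α3) ROW 2, FILE 8c: at the places `𝔩 ∣ 𝔣`, `𝔩 ∤ p` where `θ′` is RAMIFIED, the `S`-units behind a `θ′`-INVARIANT tower are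
# `p`-UNITS (memo (C-e): the `θ′`-eigen condition kills the `𝔩`-valuations in `lim←_k`)

Cell `bsd-print-cf2`, WIDTH seat `bsd-line-cf2-p1-w6` g10 (prover-bsd-line-cf2-p1-w6-g10-0), successor of g9 on (α3) ROW 2 of the JLK road on the
DECIDING child stmt-BirchSwinnertonDyer-24721 `PrintCf2RubinValueTwo.MainConjClauseAtSplitTwoQuadDA` (memo `HOME/bsd-line-cf2-p1-w6/ROW2-RHO3-SPEC-w6g9.md`
§2 (C-c)/(C-e): second step of the COKERNEL half `hgcoker` of g8's FILE 4a); `--supports` that item (helper, Theses-free). HONEST FRAMING: Kummer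
theory and valuations; the displayed hypothesis `hram` ("at every place of `F` above an `𝔩 ∈ S` prime to `p` some `δ ∈ Γ_K` with `θ′(δ) = −1` fixes
the place and the tower") is the frame's "θ′ is ramified at every `𝔩 ∣ 𝔣`, `𝔩 ∤ p`" (inertia at `𝔩` lies in `Gal(K̄/K̃_n)`, which acts trivially on
its own cohomology); nothing here closes the crux or a registered stub; no summit statement is proved by this seat; BSD is not proved by any of this.
THEOREMS ONLY (no definition, no named fact, no instance, no `sorry`).

WHAT. Setting of FILE 8b (`U = Gal(K̄/F)`, `F ⊆ K_S` a number field Galois over `K`, `θ′|_U = 1`, `S ⊇ {v ∣ p}`, a tower `(y_k)_k`,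
`red(y_{k+1}) = y_k`). By FILE 8b, `y_{j+1}` is the class of a root `β` of an `S`-unit `ε ∈ F`. Let `w ∣ 𝔩 ∈ S`, `𝔩 ∤ p`, and `δ ∈ Γ_K` with
`θ′(δ) = −1`, `δ|_F·w = w` and `δ·y_{j+1} = y_{j+1}`. The twisted conjugation law (FILE 3h) gives `δ·y_{j+1} = −c′`, `c′` the class of `δβ`; so
`c′ + y_{j+1} = 0`, i.e. `(δβ)·β = f·ζ` with `f ∈ F`, `ζ^{p^{j+1}} = 1` (FILE 3i), whence `δ(ε)·ε = f^{p^{j+1}}` in `F` and — `δ` fixing `w` —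
`2·ord_w(ε) = p^{j+1}·ord_w(f)`, so `p^j ∣ ord_w(ε)` (`p = 2` or `p` odd). Hence `y_j = red(y_{j+1})`, the class of `β^p` (a root of `ε`), satisfies the
divisibility hypothesis of the `lim←_k` ENGINE of FILE 8b at depth `j` for `T = {w ∣ p}`; the engine returns: **every `y_k` is the class of a root of a
`p`-UNIT of `F`** (`w.valuation F ε = 1` at every `w ∤ p`) — `exists_pUnit_isTwistedKummerClass_of_tower`. So after this file the cokernel of ROW 2
sees only the places above `p` (finitely many in the `ℤ_p²`-tower; FILE 8d) and the units.

presearch: «H^i of μ_{p^k} ⊗ θ′ at a place where θ′ is ramified» / JLK 2011 Lemma 4.3 "`Det RΓ(𝒪_{K_𝔩}, Λ(η)(1)) = Λ_𝒪` if `η` is ramified at `𝔩`"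
[corpus: arXiv 0804.2828 p0012:L150–157]; Burungale–Flach 2024 Lemma 7 (Euler factors only at unramified `𝔩`) [corpus: arXiv 2206.09874 p0017].
The element-level form here (valuations of `θ′`-eigen `S`-units) has no printed counterpart I could find (queries "eigenspace S-units ramified
character valuation", "Kummer class invariant conjugation ramified prime"; corpus+galaxy). beyond-print theorem: no.

References: J. Johnson-Leung, G. Kings, J. reine angew. Math. 653 (2011) §3.3 (5), Lemma 4.3; J. Neukirch, A. Schmidt, K. Wingberg (2008) VIII §3
(8.3.4); J. W. S. Cassels, A. Fröhlich, *Algebraic Number Theory* (1967) Ch. VII §1.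
-/

noncomputable section

open scoped Classical

-- the summit namespace `Summit.BirchSwinnertonDyer.BirchSwinnertonDyer` repeats the problem name by design (D-0017)
set_option linter.dupNamespace false
set_option autoImplicit false

open scoped NumberField
open Field IsDedekindDomain IntermediateField WithZero
open Literature.NumberTheory.GaloisRepresentations Literature.NumberTheory.GaloisRepresentations.DiscreteGaloisModule
open Literature.NumberTheory.GaloisRepresentations.LocalWeilDatum
open Literature.NumberTheory.ComplexMultiplication.EllipticUnits.JohnsonLeungKings2011

namespace Summit.BirchSwinnertonDyer.BirchSwinnertonDyer.Theorems.PrintCf2.RowTwo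

variable {K : Type} [Field K] [NumberField K] (p : ℕ) [Fact p.Prime] (S : Set (HeightOneSpectrum (𝓞 K)))
  (θ : absoluteGaloisGroup K →ₜ* ℤ_[p]ˣ)

/-! ## §1. Arithmetic of the exponent: `p^{j+1} ∣ 2x ⟹ p^j ∣ x` -/

omit [Fact p.Prime] in
/-- `p^{j+1} ∣ 2x ⟹ p^j ∣ x` for a prime `p` (`p = 2`: cancel a `2`; `p` odd: `p^{j+1}` is prime to `2`). [folklore] -/
theorem pow_dvd_of_pow_succ_dvd_two_mul (hp : p.Prime) {j : ℕ} {x : ℤ} (h : ((p ^ (j + 1) : ℕ) : ℤ) ∣ 2 * x) :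
    ((p ^ j : ℕ) : ℤ) ∣ x := by
  rcases hp.eq_two_or_odd' with rfl | hodd
  · rw [Nat.cast_pow, pow_succ', Nat.cast_ofNat] at h
    rw [Nat.cast_pow, Nat.cast_ofNat]
    exact Int.dvd_of_mul_dvd_mul_left two_ne_zero h
  · have hcop : Nat.Coprime (p ^ (j + 1)) 2 := Nat.Coprime.pow_left _ (Nat.Coprime.symm (Nat.coprime_two_left.mpr hodd))
    have h2 : ((p ^ (j + 1) : ℕ) : ℤ) ∣ x := by
      rw [mul_comm] at h
      exact (Nat.isCoprime_iff_coprime.mpr hcop).dvd_of_dvd_mul_right h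
    exact (Int.natCast_dvd_natCast.mpr (pow_dvd_pow p (Nat.le_succ j))).trans h2

/-! ## §2. The `θ′`-eigen condition at a ramified place makes the `𝔩`-valuation of the `S`-unit divisible -/

/-- **A class of `δβ` exists** (`F/K` finite normal, `θ′|_{Gal(K̄/F)} = 1`, `S ⊇ {v ∣ p}`, `N_S ≤ Gal(K̄/F)`): if `β ∈ K̄ˣ` is `N_S`-fixed with
`β^{p^k} = ε ∈ F`, then for every `δ ∈ Γ_K` the conjugate `δβ` (again `N_S`-fixed, `N_S ⊴ Γ_K`; `(δβ)^{p^k} = δ(ε) ∈ F`) has a twisted Kummer class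
at `Gal(K̄/F)` (FILE 3a's constructor). [cite: JohnsonLeungKings2011, §3.3 (5)–(6) (arXiv p0010:L61–70)] -/
theorem exists_isTwistedKummerClass_smul
    (hSp : ∀ v : HeightOneSpectrum (𝓞 K), ((p : ℕ) : 𝓞 K) ∈ v.asIdeal → v ∈ S)
    (F : IntermediateField K (AlgebraicClosure K)) [FiniteDimensional K F] [Normal K F]
    (hNF : ramificationSubgroup K S ≤ galFixing K F) (hθF : ∀ σ ∈ galFixing K F, θ σ = 1) {k : ℕ}
    {β : (AlgebraicClosure K)ˣ} {ε : F} (hβN : ∀ τ ∈ ramificationSubgroup K S, τ • β = β)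
    (hβε : (β : AlgebraicClosure K) ^ p ^ k = (ε : AlgebraicClosure K)) (δ : absoluteGaloisGroup K) :
    ∃ c' : levelCoh p S θ (galFixing K F) k 1, IsTwistedKummerClass p θ S (galFixing K F) k (δ • β) c' := by
  have hθN : ∀ τ ∈ ramificationSubgroup K S, θ τ = 1 := fun τ hτ ↦ hθF τ (hNF hτ)
  have hμN : ∀ τ ∈ ramificationSubgroup K S, ∀ ζ : (AlgebraicClosure K)ˣ, ζ ^ (p ^ k) = 1 → τ • ζ = ζ :=
    fun _ hτ ζ hζ ↦ smul_eq_self_of_mem_ramificationSubgroup_of_units_pow_eq_one p S k hSp hτ ζ hζ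
  have hδβpow : (((δ • β) ^ p ^ k : (AlgebraicClosure K)ˣ) : AlgebraicClosure K) = ((resGal F δ ε : F) : AlgebraicClosure K) := by
    rw [← smul_pow', Units.coe_smul, Units.val_pow_eq_pow_val, hβε, coe_resGal_apply]
  have hδβU : ∀ σ ∈ galFixing K F, (σ • (δ • β) / (δ • β)) ^ (p ^ k) = 1 := by
    intro σ hσ
    have hfix : σ • (δ • β) ^ p ^ k = (δ • β) ^ p ^ k :=
      smul_units_eq_self_of_mem_galFixing hσ (by rw [hδβpow]; exact (resGal F δ ε).2)
    rw [div_pow, ← smul_pow', hfix, div_self']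
  exact exists_isTwistedKummerClass p S θ k (galFixing K F) (isOpen_galFixing K F) hθF hθN hμN (δ • β)
    (TwistedZeta.smul_smul_eq_of_mem_normal (ramificationSubgroup K S) hβN δ) hδβU

/-- **THE RAMIFIED-PLACE STEP.** `U = Gal(K̄/F)` (`F` Galois over `K`, a number field, `N_S ≤ U`, `θ′|_U = 1`, `S ⊇ {v ∣ p}`); `y ∈ H¹(G_S(F), μ_{p^{j+1}} ⊗ θ′)`
the twisted Kummer class of an `N_S`-fixed `β` with `β^{p^{j+1}} = ε ∈ F^×`; `w` a place of `F` and `δ ∈ Γ_K` with `θ′(δ) = −1`, `δ|_F·w = w` and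
`δ·y = y`. THEN `p^j ∣ ord_w(ε)`. (FILE 3h: `δ·y = −c′`, `c′` the class of `δβ`; so the class of `(δβ)β` is `0` and `(δβ)β ∈ F·μ_{p^{j+1}}` (FILE 3i);
`p^{j+1}`-th powers: `δ(ε)·ε = f^{p^{j+1}}`, `f ∈ F`; valuations at the `δ`-fixed `w`: `2·ord_w ε = p^{j+1}·ord_w f`.)
[cite: JohnsonLeungKings2011, §3.3 (5) (arXiv p0010:L61–70)] [cite: CasselsFrohlichANT1967, Ch. VII §1 (conjugate places)] -/
theorem pow_dvd_log_valuation_of_levelConj_eq_self [IsGalois K (AlgebraicClosure K)]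
    (hSp : ∀ v : HeightOneSpectrum (𝓞 K), ((p : ℕ) : 𝓞 K) ∈ v.asIdeal → v ∈ S)
    (F : IntermediateField K (AlgebraicClosure K)) [NumberField F] [Normal K F] [(galFixing K F).Normal]
    (hNF : ramificationSubgroup K S ≤ galFixing K F) (hθF : ∀ σ ∈ galFixing K F, θ σ = 1) {j : ℕ}
    {y : levelCoh p S θ (galFixing K F) (j + 1) 1} {β : (AlgebraicClosure K)ˣ} {ε : F}
    (hβN : ∀ τ ∈ ramificationSubgroup K S, τ • β = β) (hβε : (β : AlgebraicClosure K) ^ p ^ (j + 1) = (ε : AlgebraicClosure K))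
    (hc : IsTwistedKummerClass p θ S (galFixing K F) (j + 1) β y)
    {δ : absoluteGaloisGroup K} (hθδ : θ δ = -1) {w : HeightOneSpectrum (𝓞 F)} (hδw : resGal F δ • w = w)
    (hδy : levelConj p S θ (galFixing K F) (j + 1) 1 δ y = y) :
    ((p ^ j : ℕ) : ℤ) ∣ log (w.valuation F ε) := by
  have hp : p.Prime := Fact.out
  haveI : FiniteDimensional K F := Module.Finite.of_restrictScalars_finite ℚ K F
  have hε0 : ε ≠ 0 := by
    intro h0
    rw [h0, ZeroMemClass.coe_zero] at hβε
    exact (pow_ne_zero _ β.ne_zero) hβε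
  -- `(δβ)^{p^{j+1}} = δ•ε ∈ F`
  have hδβpow : (((δ • β) ^ p ^ (j + 1) : (AlgebraicClosure K)ˣ) : AlgebraicClosure K) = ((resGal F δ ε : F) : AlgebraicClosure K) := by
    rw [← smul_pow', Units.coe_smul, Units.val_pow_eq_pow_val, hβε, coe_resGal_apply]
  -- a class `c′` of `δβ`; `δ·y = −c′`, so the class of `(δβ)β` is `0`
  obtain ⟨c', hc'⟩ := exists_isTwistedKummerClass_smul p S θ hSp F hNF hθF hβN hβε δ
  have hneg := levelConj_eq_neg_of_isTwistedKummerClass p S θ (galFixing K F) (j + 1) hc δ hθδ hc'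
  rw [hδy] at hneg
  have h0 : IsTwistedKummerClass p θ S (galFixing K F) (j + 1) (δ • β * β) 0 := by
    have h1 := isTwistedKummerClass_mul p S θ (galFixing K F) (j + 1) hc' hc
    rwa [hneg, add_neg_cancel] at h1
  obtain ⟨ζ, hζ, hfix⟩ := exists_smul_eq_of_isTwistedKummerClass_zero p S θ (j + 1) (galFixing K F) hθF h0
  -- `f = (δβ)βζ⁻¹ ∈ F` and `δ(ε)·ε = f^{p^{j+1}}`
  have hfF : ((δ • β * β * ζ⁻¹ : (AlgebraicClosure K)ˣ) : AlgebraicClosure K) ∈ F :=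
    mem_of_forall_mem_galFixing_smul_eq F fun σ hσ ↦ by rw [← Units.coe_smul, hfix σ hσ]
  set f : F := ⟨_, hfF⟩ with hfdef
  have hf0 : f ≠ 0 := fun h0 ↦ (δ • β * β * ζ⁻¹).ne_zero (congrArg Subtype.val h0)
  have heq : resGal F δ ε * ε = f ^ p ^ (j + 1) := by
    apply Subtype.ext
    change ((resGal F δ ε : F) : AlgebraicClosure K) * (ε : AlgebraicClosure K) =
      (((δ • β * β * ζ⁻¹ : (AlgebraicClosure K)ˣ) : AlgebraicClosure K)) ^ p ^ (j + 1)
    rw [← Units.val_pow_eq_pow_val, mul_pow, mul_pow, inv_pow, hζ, inv_one, mul_one, Units.val_mul, hδβpow,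
      Units.val_pow_eq_pow_val, hβε]
  -- valuations at the `δ`-fixed place `w`
  have hval : w.valuation F (resGal F δ ε) = w.valuation F ε := by
    have h1 := Literature.NumberTheory.Automorphic.HeightOneSpectrum.valuation_algEquiv_smul K (resGal F δ) w ε
    rwa [hδw] at h1
  have hvε0 : w.valuation F ε ≠ 0 := (Valuation.ne_zero_iff _).2 hε0
  have hlog : 2 * log (w.valuation F ε) = ((p ^ (j + 1) : ℕ) : ℤ) * log (w.valuation F f) := by
    have h1 := congrArg (w.valuation F) heq
    rw [map_mul, hval, map_pow] at h1
    have h2 := congrArg log h1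
    rw [log_mul hvε0 hvε0, log_pow, nsmul_eq_mul] at h2
    rw [two_mul, h2, Nat.cast_pow]
  exact pow_dvd_of_pow_succ_dvd_two_mul p hp ⟨_, hlog⟩

/-! ## §3. Towers invariant under ramified `θ′ = −1` elements consist of classes of roots of `p`-units -/

/-- **A `θ′`-RAMIFICATION-INVARIANT `k`-TOWER CONSISTS OF TWISTED KUMMER CLASSES OF ROOTS OF `p`-UNITS.** Setting of FILE 8b (`K̄/K` Galois,
`S ⊇ {v ∣ p}`, `F ⊆ K̄` a number field Galois over `K` with `N_S ≤ Gal(K̄/F)` and `θ′|_{Gal(K̄/F)} = 1`, a tower `(y_k)_k`), plus the displayed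
hypothesis **`hram`**: at every place `w` of `F` above some `𝔩 ∈ S` with `𝔩 ∤ p` there is `δ ∈ Γ_K` with `θ′(δ) = −1` which fixes `w` (through
`Gal(F/K)`) and fixes every `y_k` (conjugation action) — e.g. an inertia element at `𝔩` when `θ′` is ramified at `𝔩` and the tower is restricted from
`K̃_n ⊇` the inertia field. THEN for every `k` there are `ε ∈ F^×` with `w.valuation F ε = 1` at EVERY place `w ∤ p` of `F` (a `p`-unit) and an
`N_S`-fixed `β ∈ K̄ˣ` with `β^{p^k} = ε` whose twisted Kummer class is `y_k`. (FILE 8b §3 at depth `j+1`, §2 of this file at the ramified places, then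
FILE 8b's `lim←_k` engine with `T = {w ∣ p}`.) [cite: JohnsonLeungKings2011, §3.3 (5) and Lemma 4.3 (arXiv p0010:L61–70, p0012:L150–157)] [cite: NeukirchSchmidtWingberg2008, VIII §3 Prop. (8.3.4)] -/
theorem exists_pUnit_isTwistedKummerClass_of_tower [IsGalois K (AlgebraicClosure K)]
    (hSp : ∀ v : HeightOneSpectrum (𝓞 K), ((p : ℕ) : 𝓞 K) ∈ v.asIdeal → v ∈ S)
    (F : IntermediateField K (AlgebraicClosure K)) [NumberField F] [Normal K F] [(galFixing K F).Normal]
    (hNF : ramificationSubgroup K S ≤ galFixing K F) (hθF : ∀ σ ∈ galFixing K F, θ σ = 1)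
    (y : ∀ k : ℕ, levelCoh p S θ (galFixing K F) k 1) (hy : ∀ k, levelRed p S θ (galFixing K F) k 1 (y (k + 1)) = y k)
    (hram : ∀ w : HeightOneSpectrum (𝓞 F), w.under (𝓞 K) ∈ S → ((p : ℕ) : 𝓞 K) ∉ (w.under (𝓞 K)).asIdeal →
      ∃ δ : absoluteGaloisGroup K, θ δ = -1 ∧ resGal F δ • w = w ∧ ∀ k, levelConj p S θ (galFixing K F) k 1 δ (y k) = y k) (k : ℕ) :
    ∃ (ε : F) (β : (AlgebraicClosure K)ˣ), ε ≠ 0 ∧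
      (∀ w : HeightOneSpectrum (𝓞 F), ((p : ℕ) : 𝓞 K) ∉ (w.under (𝓞 K)).asIdeal → w.valuation F ε = 1) ∧
      (β : AlgebraicClosure K) ^ p ^ k = (ε : AlgebraicClosure K) ∧ (∀ τ ∈ ramificationSubgroup K S, τ • β = β) ∧
      IsTwistedKummerClass p θ S (galFixing K F) k β (y k) := by
  have hp : p.Prime := Fact.out
  let T : Set (HeightOneSpectrum (𝓞 F)) := {w | ((p : ℕ) : 𝓞 K) ∈ (w.under (𝓞 K)).asIdeal}
  have hdiv : ∀ j : ℕ, ∃ (β : (AlgebraicClosure K)ˣ) (b : F), b ≠ 0 ∧ (β : AlgebraicClosure K) ^ p ^ j = (b : AlgebraicClosure K) ∧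
      (∀ τ ∈ ramificationSubgroup K S, τ • β = β) ∧ IsTwistedKummerClass p θ S (galFixing K F) j β (y j) ∧
      ∀ w : HeightOneSpectrum (𝓞 F), w ∉ T → ((p ^ j : ℕ) : ℤ) ∣ log (w.valuation F b) := by
    intro j
    obtain ⟨ε, β, hε0, hεS, hβε, hβN, hc⟩ := exists_sUnit_isTwistedKummerClass_of_tower p S θ F hNF hθF y hy (j + 1)
    refine ⟨β ^ p, ε, hε0, ?_, fun τ hτ ↦ by rw [smul_pow', hβN τ hτ], ?_, fun w hw ↦ ?_⟩
    · rw [Units.val_pow_eq_pow_val, ← pow_mul, ← pow_succ', hβε]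
    · rw [← hy j]
      exact isTwistedKummerClass_levelRed p S θ (galFixing K F) j hc
    · by_cases hwS : w.under (𝓞 K) ∈ S
      · obtain ⟨δ, hθδ, hδw, hδy⟩ := hram w hwS hw
        exact pow_dvd_log_valuation_of_levelConj_eq_self p S θ hSp F hNF hθF hβN hβε hc hθδ hδw (hδy (j + 1))
      · rw [hεS w hwS, log_one]
        exact dvd_zero _
  obtain ⟨ε, β, hε0, hεT, hβε, hβN, hc⟩ :=
    exists_isTwistedKummerClass_root_of_forall_dvd p S θ F hNF T y hy hdiv k
  exact ⟨ε, β, hε0, fun w hw ↦ hεT w hw, hβε, hβN, hc⟩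

end Summit.BirchSwinnertonDyer.BirchSwinnertonDyer.Theorems.PrintCf2.RowTwo

end
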